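import Mathlib
import Summits.CriticalPhenomena.Ising3DConformalLimit.Theorems.PrimaryAtInfinityWardToMoebiusRotations

/-!
# Discontinuous groups of isometries of `ℝ³`, part 3: linear isometries of `ℝ³`

Helper file for stub `stub_groupStructure` (F) of line `purity_stacking` of the crux
`IsometryAtoms.MinimisingLawsCohesive` (stmt-AtomisticToContinuum-15777). Pure linear algebra of
`L : ℝ³ ≃ₗᵢ[ℝ] ℝ³`:

* `det L = ±1` (multiplicativity is `WardToMoebius.det_mul_linearIsometryEquiv`, imported); **Euler's rotation theorem**: `det L = 1` ⇒ `L` fixes a unit vector; and if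
  moreover `L ≠ 1` the fixed vectors form exactly that line;
* a SMALL isometry (`‖L x - x‖ ≤ δ ‖x‖` with `δ < 1`) which is an involution is the identity;
* the **commutator contraction** `‖[A, B] x - x‖ ≤ 2 a b ‖x‖` for `a`-small `A` and `b`-small `B`.
-/

noncomputable section

open scoped RealInnerProductSpace
open Module

namespace Summit.AtomisticToContinuum.Crystallization.Theorems.IsometryAtomsMinimisingLawsCohesive.GroupStructure

open Summit.CriticalPhenomena.Ising3DConformalLimit.WardToMoebius (det_mul_linearIsometryEquiv)

/-! ## Determinant of a linear isometry -/

/-- The determinant of a linear isometry of `ℝ³` is `1` or `-1`. -/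
theorem det_eq_one_or_neg_one (L : EuclideanSpace ℝ (Fin 3) ≃ₗᵢ[ℝ] EuclideanSpace ℝ (Fin 3)) :
    LinearMap.det (L.toLinearEquiv : EuclideanSpace ℝ (Fin 3) →ₗ[ℝ] EuclideanSpace ℝ (Fin 3)) = 1 ∨
    LinearMap.det (L.toLinearEquiv : EuclideanSpace ℝ (Fin 3) →ₗ[ℝ] EuclideanSpace ℝ (Fin 3)) = -1 := by
  set b := stdOrthonormalBasis ℝ (EuclideanSpace ℝ (Fin 3)) with hb
  have h := OrthonormalBasis.det_to_matrix_orthonormalBasis_real b (b.map L)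
  have hcomp : b.toBasis.det (b.map L) =
      LinearMap.det (L.toLinearEquiv : EuclideanSpace ℝ (Fin 3) →ₗ[ℝ] EuclideanSpace ℝ (Fin 3)) := by
    have h1 : (⇑(b.map L) : _ → EuclideanSpace ℝ (Fin 3)) =
        (L.toLinearEquiv : EuclideanSpace ℝ (Fin 3) →ₗ[ℝ] EuclideanSpace ℝ (Fin 3)) ∘ ⇑b.toBasis := by
      funext i; simp
    rw [h1, Basis.det_comp, Basis.det_self, mul_one]
  rwa [hcomp] at h

/-- The determinant of the inverse equals the determinant (both are `±1`). -/
theorem det_symm (A : EuclideanSpace ℝ (Fin 3) ≃ₗᵢ[ℝ] EuclideanSpace ℝ (Fin 3)) :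
    LinearMap.det (A.symm.toLinearEquiv : EuclideanSpace ℝ (Fin 3) →ₗ[ℝ] EuclideanSpace ℝ (Fin 3)) =
      LinearMap.det (A.toLinearEquiv : EuclideanSpace ℝ (Fin 3) →ₗ[ℝ] EuclideanSpace ℝ (Fin 3)) := by
  have h : LinearMap.det ((A.symm * A).toLinearEquiv : EuclideanSpace ℝ (Fin 3) →ₗ[ℝ] EuclideanSpace ℝ (Fin 3)) = 1 := by
    have : A.symm * A = 1 := by ext x; simp
    rw [this]; exact LinearMap.det_id
  rw [det_mul_linearIsometryEquiv] at h
  rcases det_eq_one_or_neg_one A with hA | hA <;> rw [hA] at h ⊢ <;> linarith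

/-- The square of a linear isometry has determinant `1`. -/
theorem det_mul_self (A : EuclideanSpace ℝ (Fin 3) ≃ₗᵢ[ℝ] EuclideanSpace ℝ (Fin 3)) :
    LinearMap.det ((A * A).toLinearEquiv : EuclideanSpace ℝ (Fin 3) →ₗ[ℝ] EuclideanSpace ℝ (Fin 3)) = 1 := by
  rw [det_mul_linearIsometryEquiv]
  rcases det_eq_one_or_neg_one A with h | h <;> rw [h] <;> norm_num

/-- The determinant is invariant under conjugation. -/
theorem det_conj (A B : EuclideanSpace ℝ (Fin 3) ≃ₗᵢ[ℝ] EuclideanSpace ℝ (Fin 3)) :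
    LinearMap.det ((B * A * B⁻¹).toLinearEquiv : EuclideanSpace ℝ (Fin 3) →ₗ[ℝ] EuclideanSpace ℝ (Fin 3)) =
      LinearMap.det (A.toLinearEquiv : EuclideanSpace ℝ (Fin 3) →ₗ[ℝ] EuclideanSpace ℝ (Fin 3)) := by
  rw [det_mul_linearIsometryEquiv, det_mul_linearIsometryEquiv]
  have hB : LinearMap.det ((B⁻¹).toLinearEquiv : EuclideanSpace ℝ (Fin 3) →ₗ[ℝ] EuclideanSpace ℝ (Fin 3)) =
      LinearMap.det (B.toLinearEquiv : EuclideanSpace ℝ (Fin 3) →ₗ[ℝ] EuclideanSpace ℝ (Fin 3)) :=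
    det_symm B
  rw [hB]
  rcases det_eq_one_or_neg_one B with h | h <;> rw [h] <;> ring

/-! ## Euler's rotation theorem -/

/-- `det Aᵀ = det A` on `ℝ³`. -/
theorem det_adjoint_eq (A : EuclideanSpace ℝ (Fin 3) →ₗ[ℝ] EuclideanSpace ℝ (Fin 3)) :
    LinearMap.det (LinearMap.adjoint A) = LinearMap.det A := by
  set b := stdOrthonormalBasis ℝ (EuclideanSpace ℝ (Fin 3)) with hb
  rw [← LinearMap.det_toMatrix b.toBasis, LinearMap.toMatrix_adjoint, Matrix.det_conjTranspose,
    LinearMap.det_toMatrix, star_trivial]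

/-- The adjoint of a linear isometry equivalence is its inverse. -/
theorem adjoint_eq_symm (L : EuclideanSpace ℝ (Fin 3) ≃ₗᵢ[ℝ] EuclideanSpace ℝ (Fin 3)) :
    LinearMap.adjoint (L.toLinearEquiv : EuclideanSpace ℝ (Fin 3) →ₗ[ℝ] EuclideanSpace ℝ (Fin 3)) =
      (L.symm.toLinearEquiv : EuclideanSpace ℝ (Fin 3) →ₗ[ℝ] EuclideanSpace ℝ (Fin 3)) := by
  symm
  rw [LinearMap.eq_adjoint_iff]
  intro x y
  change ⟪L.symm x, y⟫ = ⟪x, L y⟫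
  rw [← L.inner_map_map (L.symm x) y, L.apply_symm_apply]

/-- **Euler's rotation theorem**: a linear isometry of `ℝ³` with determinant `1` fixes a unit
vector (`det(L − 1) = det L · det(1 − Lᵀ) = det(1 − L) = −det(L − 1)`). -/
theorem exists_fixed_unit_of_det_eq_one (L : EuclideanSpace ℝ (Fin 3) ≃ₗᵢ[ℝ] EuclideanSpace ℝ (Fin 3))
    (hdet : LinearMap.det (L.toLinearEquiv : EuclideanSpace ℝ (Fin 3) →ₗ[ℝ] EuclideanSpace ℝ (Fin 3)) = 1) :
    ∃ u : EuclideanSpace ℝ (Fin 3), ‖u‖ = 1 ∧ L u = u := by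
  set A : EuclideanSpace ℝ (Fin 3) →ₗ[ℝ] EuclideanSpace ℝ (Fin 3) :=
    (L.toLinearEquiv : EuclideanSpace ℝ (Fin 3) →ₗ[ℝ] EuclideanSpace ℝ (Fin 3)) with hA
  set B : EuclideanSpace ℝ (Fin 3) →ₗ[ℝ] EuclideanSpace ℝ (Fin 3) :=
    (L.symm.toLinearEquiv : EuclideanSpace ℝ (Fin 3) →ₗ[ℝ] EuclideanSpace ℝ (Fin 3)) with hB
  have hAB : A * B = 1 := by
    apply LinearMap.ext; intro x
    change L (L.symm x) = x
    exact L.apply_symm_apply x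
  have hadj : LinearMap.adjoint A = B := adjoint_eq_symm L
  have h3 : Module.finrank ℝ (EuclideanSpace ℝ (Fin 3)) = 3 := finrank_euclideanSpace_fin
  have e1 : A - 1 = A * (1 - B) := by rw [mul_sub, mul_one, hAB]
  have e2 : (1 : EuclideanSpace ℝ (Fin 3) →ₗ[ℝ] EuclideanSpace ℝ (Fin 3)) - B = LinearMap.adjoint (1 - A) := by
    rw [map_sub, hadj, Module.End.one_eq_id, LinearMap.adjoint_id]
  have e3 : LinearMap.det (A - 1) = LinearMap.det (1 - A) := by
    rw [e1, map_mul, hdet, one_mul, e2, det_adjoint_eq]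
  have e4 : LinearMap.det ((1 : EuclideanSpace ℝ (Fin 3) →ₗ[ℝ] EuclideanSpace ℝ (Fin 3)) - A) = -LinearMap.det (A - 1) := by
    rw [show (1 : EuclideanSpace ℝ (Fin 3) →ₗ[ℝ] EuclideanSpace ℝ (Fin 3)) - A = (-1 : ℝ) • (A - 1) by
      rw [neg_one_smul, neg_sub], LinearMap.det_smul, h3]
    norm_num
  have hdet0 : LinearMap.det (A - 1) = 0 := by linarith
  obtain ⟨v, hv, hv0⟩ := Submodule.exists_mem_ne_zero_of_ne_bot
    (LinearMap.det_eq_zero_iff_ker_ne_bot.1 hdet0)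
  have hfix : L v = v := by
    have h : (A - 1) v = 0 := hv
    rw [LinearMap.sub_apply, Module.End.one_apply, sub_eq_zero] at h
    exact h
  have hvn : ‖v‖ ≠ 0 := norm_ne_zero_iff.2 hv0
  refine ⟨‖v‖⁻¹ • v, ?_, ?_⟩
  · rw [norm_smul, norm_inv, norm_norm, inv_mul_cancel₀ hvn]
  · rw [map_smul, hfix]

/-! ## The fixed vectors of a nontrivial rotation form a line -/

/-- A linear isometry fixing every vector of a basis is the identity. -/
theorem eq_one_of_fixed_basis {ι : Type*} [Fintype ι] (b : Basis ι ℝ (EuclideanSpace ℝ (Fin 3)))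
    {L : EuclideanSpace ℝ (Fin 3) ≃ₗᵢ[ℝ] EuclideanSpace ℝ (Fin 3)} (h : ∀ i, L (b i) = b i) : L = 1 := by
  apply LinearIsometryEquiv.toLinearEquiv_injective
  apply b.ext'
  intro i
  simpa using h i

/-- **The fixed set of a nontrivial rotation is a line**: if `det L = 1`, `L u = u` with
`u ≠ 0`, and `L` fixes a vector `w` outside the line `ℝ u`, then `L = 1`. -/
theorem eq_one_of_fixed_of_fixed {L : EuclideanSpace ℝ (Fin 3) ≃ₗᵢ[ℝ] EuclideanSpace ℝ (Fin 3)}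
    (hdet : LinearMap.det (L.toLinearEquiv : EuclideanSpace ℝ (Fin 3) →ₗ[ℝ] EuclideanSpace ℝ (Fin 3)) = 1)
    {u w : EuclideanSpace ℝ (Fin 3)} (hu : L u = u) (hw : L w = w)
    (huw : LinearIndependent ℝ ![u, w]) : L = 1 := by
  -- a unit vector `m` orthogonal to the plane `span {u, w}`
  set P2 : Submodule ℝ (EuclideanSpace ℝ (Fin 3)) := Submodule.span ℝ (Set.range ![u, w]) with hP2
  have hP2rank : finrank ℝ P2 = 2 := by rw [hP2, finrank_span_eq_card huw]; simp
  have hP2orth : finrank ℝ P2ᗮ = 1 := by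
    have := Submodule.finrank_add_finrank_orthogonal P2
    rw [hP2rank, finrank_euclideanSpace, Fintype.card_fin] at this
    omega
  have hne : P2ᗮ ≠ ⊥ := by
    intro h; rw [h, finrank_bot] at hP2orth; exact zero_ne_one hP2orth
  obtain ⟨m, hmP2, hm0⟩ := Submodule.exists_mem_ne_zero_of_ne_bot hne
  -- `L` fixes `P2` pointwise, hence maps `m` into `P2ᗮ = ℝ m`
  have hfixP2 : ∀ x ∈ P2, L x = x := by
    intro x hx
    refine Submodule.span_induction (fun y hy => ?_) (by simp) (fun a b _ _ ha hb => ?_)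
      (fun c a _ ha => ?_) hx
    · obtain ⟨i, rfl⟩ := hy
      fin_cases i
      · exact hu
      · exact hw
    · rw [map_add, ha, hb]
    · rw [map_smul, ha]
  have hLm : L m ∈ P2ᗮ := by
    rw [Submodule.mem_orthogonal]
    intro x hx
    calc ⟪x, L m⟫ = ⟪L x, L m⟫ := by rw [hfixP2 x hx]
      _ = ⟪x, m⟫ := L.inner_map_map x m
      _ = 0 := (Submodule.mem_orthogonal P2 m).1 hmP2 x hx
  have hspan : P2ᗮ = Submodule.span ℝ {m} := by
    refine (Submodule.eq_of_le_of_finrank_eq ?_ ?_).symm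
    · rw [Submodule.span_singleton_le_iff_mem]; exact hmP2
    · rw [hP2orth, finrank_span_singleton hm0]
  rw [hspan, Submodule.mem_span_singleton] at hLm
  obtain ⟨c, hc⟩ := hLm
  have hc1 : c = 1 ∨ c = -1 := by
    have hnorm : ‖c • m‖ = ‖m‖ := by rw [hc, L.norm_map]
    rw [norm_smul, Real.norm_eq_abs] at hnorm
    have hmn : ‖m‖ ≠ 0 := norm_ne_zero_iff.2 hm0
    have : |c| = 1 := by
      have := mul_right_cancel₀ hmn (hnorm.trans (one_mul ‖m‖).symm)
      exact this
    rcases abs_eq (zero_le_one) |>.1 this with h | h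
    · exact Or.inl h
    · exact Or.inr h
  -- the basis `(u, w, m)`
  have hmP2' : m ∉ P2 := by
    intro h
    have := (Submodule.mem_orthogonal P2 m).1 hmP2 m h
    rw [real_inner_self_eq_norm_sq] at this
    have : ‖m‖ = 0 := by nlinarith [norm_nonneg m]
    exact hm0 (norm_eq_zero.1 this)
  have hind : LinearIndependent ℝ (Fin.cons m ![u, w] : Fin 3 → EuclideanSpace ℝ (Fin 3)) :=
    linearIndependent_finCons.2 ⟨huw, hmP2'⟩
  let b : Basis (Fin 3) ℝ (EuclideanSpace ℝ (Fin 3)) := basisOfLinearIndependentOfCardEqFinrank hind (by simp)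
  have hb : ∀ i, b i = (Fin.cons m ![u, w] : Fin 3 → EuclideanSpace ℝ (Fin 3)) i := fun i =>
    congrFun (coe_basisOfLinearIndependentOfCardEqFinrank hind (by simp)) i
  rcases hc1 with h1 | h1
  · -- `L m = m`: `L` fixes the basis
    rw [h1, one_smul] at hc
    apply eq_one_of_fixed_basis b
    intro i
    rw [hb]
    refine Fin.cases ?_ (fun j => ?_) i
    · simpa using hc.symm
    · fin_cases j
      · simpa using hu
      · simpa using hw
  · -- `L m = -m`: the determinant would be `-1`
    exfalso
    rw [h1, neg_one_smul] at hc
    have hdiag : LinearMap.toMatrix b b (L.toLinearEquiv : EuclideanSpace ℝ (Fin 3) →ₗ[ℝ] EuclideanSpace ℝ (Fin 3)) =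
        Matrix.diagonal ![-1, 1, 1] := by
      ext i j
      rw [LinearMap.toMatrix_apply]
      have hLbj : (L.toLinearEquiv : EuclideanSpace ℝ (Fin 3) →ₗ[ℝ] EuclideanSpace ℝ (Fin 3)) (b j) =
          (![-1, 1, 1] j : ℝ) • b j := by
        change L (b j) = _
        rw [hb]
        refine Fin.cases ?_ (fun k => ?_) j
        · simp [← hc]
        · fin_cases k
          · simp [hu]
          · simp [hw]
      rw [hLbj, map_smul, Basis.repr_self, Matrix.diagonal_apply, Finsupp.smul_apply,
        Finsupp.single_apply]
      by_cases hij : i = j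
      · subst hij; simp
      · have hji : j ≠ i := fun h => hij h.symm
        simp [hij, hji]
    have := LinearMap.det_toMatrix b (L.toLinearEquiv : EuclideanSpace ℝ (Fin 3) →ₗ[ℝ] EuclideanSpace ℝ (Fin 3))
    rw [hdiag, Matrix.det_diagonal, hdet] at this
    simp [Fin.prod_univ_three] at this
    norm_num at this

/-- Variant: under `det L = 1`, `L ≠ 1` and `L u = u` (`u ≠ 0`), every fixed vector of `L` is a
multiple of `u`. -/
theorem fixed_mem_span_of_ne_one {L : EuclideanSpace ℝ (Fin 3) ≃ₗᵢ[ℝ] EuclideanSpace ℝ (Fin 3)}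
    (hdet : LinearMap.det (L.toLinearEquiv : EuclideanSpace ℝ (Fin 3) →ₗ[ℝ] EuclideanSpace ℝ (Fin 3)) = 1)
    (hL : L ≠ 1) {u : EuclideanSpace ℝ (Fin 3)} (hu0 : u ≠ 0) (hu : L u = u)
    {w : EuclideanSpace ℝ (Fin 3)} (hw : L w = w) : ∃ c : ℝ, w = c • u := by
  by_contra hcon
  push Not at hcon
  apply hL
  refine eq_one_of_fixed_of_fixed hdet hu hw ?_
  rw [LinearIndependent.pair_iff' hu0]
  intro c hc
  exact hcon c (by simpa using hc.symm)

/-! ## Small isometries -/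

/-- An involutive linear isometry that moves every vector by less than its norm is the identity:
if `L x ≠ x` then `w = L x - x ≠ 0` is reversed by `L`, so `‖L w - w‖ = 2 ‖w‖`. -/
theorem eq_one_of_small_of_mul_self {L : EuclideanSpace ℝ (Fin 3) ≃ₗᵢ[ℝ] EuclideanSpace ℝ (Fin 3)} {δ : ℝ} (hδ : δ < 1)
    (hsmall : ∀ x, ‖L x - x‖ ≤ δ * ‖x‖) (hinv : L * L = 1) : L = 1 := by
  ext x : 1
  by_contra hx
  change L x ≠ x at hx
  set w := L x - x with hw
  have hw0 : w ≠ 0 := sub_ne_zero.2 hx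
  have hLw : L w = -w := by
    have hLL : L (L x) = x := by
      have := congrArg (fun M : EuclideanSpace ℝ (Fin 3) ≃ₗᵢ[ℝ] EuclideanSpace ℝ (Fin 3) => M x) hinv
      simpa using this
    rw [hw, map_sub, hLL]; abel
  have h1 : ‖L w - w‖ = 2 * ‖w‖ := by
    rw [hLw, show -w - w = (-2 : ℝ) • w by rw [neg_smul, two_smul]; abel, norm_smul]
    norm_num
  have h2 := hsmall w
  rw [h1] at h2
  have hwpos : 0 < ‖w‖ := norm_pos_iff.2 hw0
  nlinarith

/-- Smallness is symmetric under inversion: `‖L⁻¹ x - x‖ = ‖L y - y‖` with `y = L⁻¹ x`. -/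
theorem small_symm {L : EuclideanSpace ℝ (Fin 3) ≃ₗᵢ[ℝ] EuclideanSpace ℝ (Fin 3)} {δ : ℝ}
    (hsmall : ∀ x, ‖L x - x‖ ≤ δ * ‖x‖) (x : EuclideanSpace ℝ (Fin 3)) : ‖L.symm x - x‖ ≤ δ * ‖x‖ := by
  have h := hsmall (L.symm x)
  rw [L.apply_symm_apply, LinearIsometryEquiv.norm_map] at h
  rwa [← norm_neg, neg_sub]

/-- Smallness is invariant under conjugation. -/
theorem small_conj {A B : EuclideanSpace ℝ (Fin 3) ≃ₗᵢ[ℝ] EuclideanSpace ℝ (Fin 3)} {δ : ℝ}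
    (hsmall : ∀ x, ‖A x - x‖ ≤ δ * ‖x‖) (x : EuclideanSpace ℝ (Fin 3)) : ‖(B * A * B⁻¹) x - x‖ ≤ δ * ‖x‖ := by
  have h := hsmall (B⁻¹ x)
  have hx : ‖B⁻¹ x‖ = ‖x‖ := LinearIsometryEquiv.norm_map _ _
  rw [hx] at h
  calc ‖(B * A * B⁻¹) x - x‖ = ‖B (A (B⁻¹ x)) - B (B⁻¹ x)‖ := by
        congr 1
        change B (A (B⁻¹ x)) - x = _
        congr 1
        change x = B (B.symm x)
        rw [B.apply_symm_apply]
    _ = ‖A (B⁻¹ x) - B⁻¹ x‖ := by rw [← map_sub, LinearIsometryEquiv.norm_map]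
    _ ≤ δ * ‖x‖ := h

/-- **Commutator contraction**: if `A` is `a`-small and `B` is `b`-small (`a, b ≥ 0`) then the
commutator `A B A⁻¹ B⁻¹` is `2ab`-small (`[A,B] − 1 = (AB − BA) A⁻¹ B⁻¹` and
`AB − BA = (A−1)(B−1) − (B−1)(A−1)`). -/
theorem small_commutator {A B : EuclideanSpace ℝ (Fin 3) ≃ₗᵢ[ℝ] EuclideanSpace ℝ (Fin 3)} {a b : ℝ}
    (ha0 : 0 ≤ a) (hb0 : 0 ≤ b)
    (ha : ∀ x, ‖A x - x‖ ≤ a * ‖x‖) (hb : ∀ x, ‖B x - x‖ ≤ b * ‖x‖) (x : EuclideanSpace ℝ (Fin 3)) :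
    ‖(A * B * A⁻¹ * B⁻¹) x - x‖ ≤ 2 * a * b * ‖x‖ := by
  set y := A⁻¹ (B⁻¹ x) with hy
  have hyn : ‖y‖ = ‖x‖ := by rw [hy, LinearIsometryEquiv.norm_map, LinearIsometryEquiv.norm_map]
  have hx' : x = B (A y) := by
    rw [hy]
    change x = B (A (A.symm (B.symm x)))
    rw [A.apply_symm_apply, B.apply_symm_apply]
  have hcomm : (A * B * A⁻¹ * B⁻¹) x = A (B y) := rfl
  have hrew : (A * B * A⁻¹ * B⁻¹) x - x = A (B y) - B (A y) := by
    nth_rw 2 [hx']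
    rw [hcomm]
  -- `A (B y) - B (A y) = (A-1)((B-1) y) - (B-1)((A-1) y)`
  have key : A (B y) - B (A y) = (A (B y - y) - (B y - y)) - (B (A y - y) - (A y - y)) := by
    simp only [map_sub]; abel
  rw [hrew, key]
  have h1 : ‖A (B y - y) - (B y - y)‖ ≤ a * (b * ‖y‖) :=
    (ha _).trans (mul_le_mul_of_nonneg_left (hb y) ha0)
  have h2 : ‖B (A y - y) - (A y - y)‖ ≤ b * (a * ‖y‖) :=
    (hb _).trans (mul_le_mul_of_nonneg_left (ha y) hb0)
  calc ‖A (B y - y) - (B y - y) - (B (A y - y) - (A y - y))‖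
      ≤ ‖A (B y - y) - (B y - y)‖ + ‖B (A y - y) - (A y - y)‖ := norm_sub_le _ _
    _ ≤ a * (b * ‖y‖) + b * (a * ‖y‖) := add_le_add h1 h2
    _ = 2 * a * b * ‖x‖ := by rw [hyn]; ring

/-- Anchor (registered sub-goal of `stub_groupStructure`): **Euler's rotation theorem** for linear
isometries of `ℝ³` of determinant one, in closed form. -/
theorem groupStructure_euler_axis : ∀ L : EuclideanSpace ℝ (Fin 3) ≃ₗᵢ[ℝ] EuclideanSpace ℝ (Fin 3), LinearMap.det (L.toLinearEquiv : EuclideanSpace ℝ (Fin 3) →ₗ[ℝ] EuclideanSpace ℝ (Fin 3)) = 1 → ∃ u : EuclideanSpace ℝ (Fin 3), ‖u‖ = 1 ∧ L u = u := by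
  intro L h
  exact exists_fixed_unit_of_det_eq_one L h

end Summit.AtomisticToContinuum.Crystallization.Theorems.IsometryAtomsMinimisingLawsCohesive.GroupStructure

end
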